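import Summits.AtomisticToContinuum.Crystallization.Theorems.OverbindingBudgetAffineCompressedCutCharts
import Summits.AtomisticToContinuum.Crystallization.Theorems.OverbindingBudgetAffineCompressedCutScale
import Summits.AtomisticToContinuum.Crystallization.Theorems.OverbindingBudgetAffineCompressedCutKernelGrowth

/-!
# NODE g81 «Establish», toward the open leaf NS♭₂ — the ESTABLISHMENT ENGINE of the layer-rigidity induction, part A: one-parent establishment and
# chart uniqueness (rider R2, engine half, file 1 of 2)

Route `OverbindingBudget` (Crystallization), crux `RobustDefectLimitWindows` (stmt-AtomisticToContinuum-31280), decomp-a2c lens 4, generation 81.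
Open leaf of record: `…OverbindingBudgetAffineCompressedCutFirst….NearFieldSlackMinSecond 12 (1/25)` («NS♭₂») ⟸ 79K ⟸ LR(r₁) (critic row 1428 (b)),
plan R1 «ExactStep» (delivered: `…CompressedCutExact`, `…CompressedCutCharts`) → R2 «Seed» → R3 «Stack» → R4 «LR(r₁)».

WHAT THIS FILE PROVES (potential-free, sorry-free).  The induction of R2/R3 establishes the sites of the `(12, 10⁻⁴, 10⁻³)`-affinely deep ball one
LATTICE POINT at a time.  An ESTABLISHED site `j` (`Estab`, §1) carries three pieces of data relative to the base site `i`, the frame / pattern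
assignments `A, P` and a fixed BASE FRAME `B : ℝ³ →ₗ ℝ³` (at the seed `B = nn_i·A_i`; after the O8 normalisation `B = nn_i·A_i ∘ Φ_s`, file 2):
  (C) a CHART `M_j` (exact linear isometry) carrying `j`'s pattern onto an integer copy `C_j` (`…Charts.Carries`);
  (L) a FRAME LINK `‖nn_j·A_j x − B (M_j x)‖ ≤ τ_j·‖x‖` (operator form, additive under transport, `link_comp`);
  (P) a POSITION `‖(y_j − y_i) − B (mv λ_j)‖ ≤ D_j` at an integer LABEL `λ_j`.
* §0 `nearestDist_pos_of_frame` (a framed site has `0 < nn`), `site_eq_of_close` (METRIC EXCLUSION: two sites predicted at one point within `Δ₁ + Δ₂ < nn`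
  coincide).
* §1 `Estab`; `estab_seed` (the base site: `M = id`, `τ = D = 0`, `λ = 0`); `child_position` (a registered first-shell point `v` of `j` charted to `mv x`
  sits at label `λ_j + x` within `D_j + 10⁻⁴·nn_j + τ_j`); `bond_exact` (the scale hypotheses of `…Exact.exact_step_record` DISCHARGED from the affine
  frames by `…Scale.affFramed_scale_transfer_record`, and `k ≠ j`; every establishment step RETURNS `0.9967·nn_j ≤ nn_k ≤ 1.0011·nn_j`); `link_comp`; ★★ `estab_child_one`: ONE-PARENT ESTABLISHMENT — from an established `j`,
  a first-shell copy vector `x ∈ C_j` and the two one-parent kernel tables (fcc child / hcp child) the child site `k` registered at `M_j⁻¹(mv x)` is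
  established with chart `M_j ∘ R₁` onto a table copy, link `τ_j + (5/2)(2·10⁻⁴·nn_j + 10⁻⁴·nn_k)`, position `D_j + 10⁻⁴·nn_j + τ_j` at label
  `λ_j + x`, together with the exact dictionary `R₁` of the bond (kept for later cocycles); record instance `estab_child_fcc` (tables KF).
* §2 CHART UNIQUENESS BY FRAME LINK: `frame_lower` (an affine frame `θ`-close to an isometry on the pattern is bounded below by `1 − 5θ/2` in operator
  norm, via `…Op.op_of_tetra_bound_all`), `base_lower` (the seed base frame: `399/400·nn_i`), `link_nonneg`, `charts_close` (two charts of one site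
  linked to the same base frame differ by `≤ (τ + τ′)/β` in operator norm), `copies_separated` (the four aligned copies are `1`-separated, by `decide`),
  ★ `chart_eq_of_carries` (two charts carrying one pattern onto the same copy and `< 1` apart on the pattern are EQUAL: they agree on the pattern, which
  spans `ℝ³`) — the tool that makes establishment ORDER-INDEPENDENT without global bookkeeping; small integer identities `norm_sub_eq_one_of_chart`,
  `tadd_tsub_cancel`, `tsq_tsub_tsub`.
File 2 (`…CompressedCutEstablishTwo`): the O8 flips and ★★ `parent_link` / `estab_child_two` (TWO-PARENT ESTABLISHMENT through the cocycle).

Deps: `…CompressedCutCharts` (R1), `…CompressedCutScale` (scale transfer), `…CompressedCutKernelGrowth` (record instance only).  No `instance`, no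
`notation`, no `set_option`, no new axioms, 0 sorry.
-/


namespace Summit.AtomisticToContinuum.Crystallization.Theorems.OverbindingBudgetAffineCompressedCutEstablish

open Literature.Geometry.DiscreteGeometry (nearestDist nearestDist_nonneg nearestDist_le_dist exists_nearestDist_eq_dist fccTwoShellPattern
  hcpTwoShellPattern card_eq_eighteen_of_twoShellPattern norm_le_sqrt_two_of_mem_twoShellPattern intVec intVec_apply)
open Summit.AtomisticToContinuum.Crystallization.Theorems.OverbindingBudgetAffineLadder (AffFramed)
open Summit.AtomisticToContinuum.Crystallization.Theorems.OverbindingBudgetAffineCompressedCutScale (affFramed_scale_transfer_record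
  nearestDist_le_of_dist_le norm_frame_le one_sub_le_norm_frame)
open Summit.AtomisticToContinuum.Crystallization.Theorems.OverbindingBudgetAffineCompressedCutOp (op_of_tetra_bound_all)
open Summit.AtomisticToContinuum.Crystallization.Theorems.OverbindingBudgetAffineCompressedCutStep (tetra_exists_pattern)
open Summit.AtomisticToContinuum.Crystallization.Theorems.OverbindingBudgetAffineCompressedCutKernel (T3 tsub tadd tneg tsq tdet thsum toV
  toV_apply_zero toV_apply_one toV_apply_two tflip fccL hcpL fccNegL hcpAltL hexL capL mem_capL hcpFamilyL kernelOneB kernelTwoB fccShellL kf_fcc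
  kf_hcp)
open Summit.AtomisticToContinuum.Crystallization.Theorems.OverbindingBudgetAffineCompressedCutExact (ExactDict exact_step_record exactDict_cocycle
  linearMap_eq_of_eq_on_triple)
open Summit.AtomisticToContinuum.Crystallization.Theorems.OverbindingBudgetAffineCompressedCutCharts (mv mv_tadd mv_tsub mv_tneg mv_zero mv_injective
  norm_mv_sq norm_mv_eq_one_iff ListedBy listedBy_fcc listedBy_hcp Carries carries_id_of_listedBy ChartDict chartDict_of_exactDict chartDict_of_cocycle
  kernel_step_one kernel_step_two linearIndependent_mv linearIndependent_of_chart)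

variable {N : ℕ}

/-! ## §0  Two elementary facts about `nearestDist` -/

/-- In an injective configuration with a second site the nearest-neighbour distance is positive. [folklore] -/
private theorem nearestDist_pos_of_ne' {y : Fin N → EuclideanSpace ℝ (Fin 3)} (hy : Function.Injective y) {i k : Fin N} (hk : k ≠ i) :
    0 < nearestDist y i := by
  obtain ⟨k₀, hk₀, h⟩ := exists_nearestDist_eq_dist y ⟨k, hk⟩
  rw [h]
  exact dist_pos.2 fun e => hk₀ (hy e).symm

/-- A site whose pattern is registered injectively inside the configuration has a second site, hence `0 < nn`. [this file] -/
theorem nearestDist_pos_of_frame {y : Fin N → EuclideanSpace ℝ (Fin 3)} (hy : Function.Injective y) {j : Fin N}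
    {Pj : Finset (EuclideanSpace ℝ (Fin 3))} {fj : EuclideanSpace ℝ (Fin 3) → EuclideanSpace ℝ (Fin 3)}
    (hP : Pj = fccTwoShellPattern ∨ Pj = hcpTwoShellPattern) (hf : ∀ v ∈ Pj, fj v ∈ Set.range y) (hinj : Set.InjOn fj ↑Pj) :
    0 < nearestDist y j := by
  have hc : 1 < Pj.card := by rw [card_eq_eighteen_of_twoShellPattern hP]; norm_num
  obtain ⟨a, ha, b, hb, hab⟩ := Finset.one_lt_card.1 hc
  obtain ⟨k₁, hk₁⟩ := hf a ha
  obtain ⟨k₂, hk₂⟩ := hf b hb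
  by_cases h₁ : k₁ = j
  · by_cases h₂ : k₂ = j
    · exact absurd (hinj ha hb (by rw [← hk₁, ← hk₂, h₁, h₂])) hab
    · exact nearestDist_pos_of_ne' hy h₂
  · exact nearestDist_pos_of_ne' hy h₁

/-- METRIC EXCLUSION: two sites whose positions relative to `y i` are within `Δ₁`, `Δ₂` of one point, with `Δ₁ + Δ₂ < nn_k`, coincide. [this file] -/
theorem site_eq_of_close {y : Fin N → EuclideanSpace ℝ (Fin 3)} {i m k : Fin N} {c : EuclideanSpace ℝ (Fin 3)} {Δ₁ Δ₂ : ℝ}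
    (hm : ‖y m - y i - c‖ ≤ Δ₁) (hk : ‖y k - y i - c‖ ≤ Δ₂) (h : Δ₁ + Δ₂ < nearestDist y k) : m = k := by
  by_contra hmk
  have h1 := nearestDist_le_dist y (j := k) (k := m) hmk
  have h2 : dist (y k) (y m) ≤ Δ₁ + Δ₂ := by
    rw [dist_eq_norm]
    have e : y k - y m = (y k - y i - c) - (y m - y i - c) := by abel
    rw [e]
    exact (norm_sub_le _ _).trans (by linarith)
  linarith

/-! ## §1  Established sites and ONE-PARENT ESTABLISHMENT -/

/-- ★ **ESTABLISHED SITE.**  Relative to the base site `i`, the frame assignment `A`, the pattern assignment `P` and the base frame `B`: the chart `M` carries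
`P j` onto the copy `C`; the FRAME LINK `‖nn_j·A_j x − B (M x)‖ ≤ τ·‖x‖`; the POSITION `‖(y_j − y_i) − B (mv λ)‖ ≤ D`. [this file] -/
def Estab (y : Fin N → EuclideanSpace ℝ (Fin 3)) (A : Fin N → (EuclideanSpace ℝ (Fin 3) →ₗ[ℝ] EuclideanSpace ℝ (Fin 3)))
    (P : Fin N → Finset (EuclideanSpace ℝ (Fin 3))) (B : EuclideanSpace ℝ (Fin 3) →ₗ[ℝ] EuclideanSpace ℝ (Fin 3)) (i j : Fin N)
    (M : EuclideanSpace ℝ (Fin 3) →ₗᵢ[ℝ] EuclideanSpace ℝ (Fin 3)) (C : List T3) (lam : T3) (τ D : ℝ) : Prop :=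
  Carries M (P j) C ∧ (∀ x, ‖nearestDist y j • A j x - B (M x)‖ ≤ τ * ‖x‖) ∧ ‖y j - y i - B (mv lam)‖ ≤ D

/-- **SEED.**  The base site is established with the identity chart onto any list listing its pattern, base frame `nn_i·A_i`, `τ = D = 0`, label `0`. [this file] -/
theorem estab_seed {y : Fin N → EuclideanSpace ℝ (Fin 3)} {A : Fin N → (EuclideanSpace ℝ (Fin 3) →ₗ[ℝ] EuclideanSpace ℝ (Fin 3))}
    {P : Fin N → Finset (EuclideanSpace ℝ (Fin 3))} {i : Fin N} {S : List T3} (hL : ListedBy (P i) S) :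
    Estab y A P (nearestDist y i • A i) i i LinearIsometry.id S (0, 0, 0) 0 0 := by
  refine ⟨carries_id_of_listedBy hL, fun x => ?_, ?_⟩
  · rw [LinearIsometry.coe_id, id, LinearMap.smul_apply, sub_self, norm_zero, zero_mul]
  · rw [mv_zero, map_zero, sub_self, sub_zero, norm_zero]

/-- **CHILD POSITION.**  A first-shell point `v` of the established `j`, charted to `mv x` and registering the site `k`, puts `k` at label `λ_j + x` within
`D_j + 10⁻⁴·nn_j + τ_j`. [this file] -/
theorem child_position {y : Fin N → EuclideanSpace ℝ (Fin 3)} {A : Fin N → (EuclideanSpace ℝ (Fin 3) →ₗ[ℝ] EuclideanSpace ℝ (Fin 3))}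
    {P : Fin N → Finset (EuclideanSpace ℝ (Fin 3))} {B : EuclideanSpace ℝ (Fin 3) →ₗ[ℝ] EuclideanSpace ℝ (Fin 3)} {i j k : Fin N}
    {M : EuclideanSpace ℝ (Fin 3) →ₗᵢ[ℝ] EuclideanSpace ℝ (Fin 3)} {C : List T3} {lam : T3} {τ D : ℝ} (hE : Estab y A P B i j M C lam τ D)
    {fj : EuclideanSpace ℝ (Fin 3) → EuclideanSpace ℝ (Fin 3)}
    (hfj : ∀ v ∈ P j, fj v ∈ Set.range y ∧ dist (fj v) (y j + nearestDist y j • A j v) ≤ 1 / 10 ^ 4 * nearestDist y j)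
    {v : EuclideanSpace ℝ (Fin 3)} (hv : v ∈ P j) (hv1 : ‖v‖ = 1) {x : T3} (hMv : M v = mv x) (hk : fj v = y k) :
    ‖y k - y i - B (mv (tadd lam x))‖ ≤ D + 1 / 10 ^ 4 * nearestDist y j + τ := by
  have h1 := (hfj v hv).2
  rw [hk, dist_eq_norm] at h1
  have h2 := hE.2.1 v
  rw [hv1, mul_one, hMv] at h2
  have h3 := hE.2.2
  have e : y k - y i - B (mv (tadd lam x)) =
      (y k - (y j + nearestDist y j • A j v)) + (nearestDist y j • A j v - B (mv x)) + (y j - y i - B (mv lam)) := by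
    rw [mv_tadd, map_add]; abel
  rw [e]
  have h4 := norm_add_le ((y k - (y j + nearestDist y j • A j v)) + (nearestDist y j • A j v - B (mv x))) (y j - y i - B (mv lam))
  have h5 := norm_add_le (y k - (y j + nearestDist y j • A j v)) (nearestDist y j • A j v - B (mv x))
  linarith

/-- **EXACT DICTIONARY OF A BOND INSIDE THE BALL** (the scale hypotheses of `…Exact.exact_step_record` discharged).  Frame, pattern and registration
assignments `A, Qf, P, f` at the record constants on the ball `dist (y ·) (y i) ≤ r`; `j` and `k` in the ball, `v ∈ P j` a first-shell point registering
`k`.  Then `k ≠ j`, the two scales compare as `0.9967·nn_j ≤ nn_k ≤ 1.0011·nn_j`, and the exact dictionary `R₁` of the bond exists. [this file] -/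
theorem bond_exact {y : Fin N → EuclideanSpace ℝ (Fin 3)} (hy : Function.Injective y) {r : ℝ} {i j k : Fin N}
    {A : Fin N → (EuclideanSpace ℝ (Fin 3) →ₗ[ℝ] EuclideanSpace ℝ (Fin 3))} {Qf : Fin N → (EuclideanSpace ℝ (Fin 3) →ₗᵢ[ℝ] EuclideanSpace ℝ (Fin 3))}
    {P : Fin N → Finset (EuclideanSpace ℝ (Fin 3))} {f : Fin N → EuclideanSpace ℝ (Fin 3) → EuclideanSpace ℝ (Fin 3)}
    (hP : ∀ j, dist (y j) (y i) ≤ r → (P j = fccTwoShellPattern ∨ P j = hcpTwoShellPattern))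
    (hA : ∀ j, dist (y j) (y i) ≤ r → ∀ v ∈ P j, ‖A j v - Qf j v‖ ≤ 1 / 1000)
    (hf : ∀ j, dist (y j) (y i) ≤ r → ∀ v ∈ P j, f j v ∈ Set.range y ∧ dist (f j v) (y j + nearestDist y j • A j v) ≤ 1 / 10 ^ 4 * nearestDist y j)
    (hinj : ∀ j, dist (y j) (y i) ≤ r → Set.InjOn (f j) ↑(P j))
    (hex : ∀ j, dist (y j) (y i) ≤ r → ∀ m, m ≠ j → dist (y m) (y j) ≤ (3 / 2 + 1 / 450) * nearestDist y j → ∃ v ∈ P j, f j v = y m)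
    (hj : dist (y j) (y i) ≤ r) (hkr : dist (y k) (y i) ≤ r)
    {v : EuclideanSpace ℝ (Fin 3)} (hv : v ∈ P j) (hv1 : ‖v‖ = 1) (hk : f j v = y k) :
    k ≠ j ∧ 9967 / 10000 * nearestDist y j ≤ nearestDist y k ∧ nearestDist y k ≤ 10011 / 10000 * nearestDist y j ∧
      ∃ R₁ : EuclideanSpace ℝ (Fin 3) →ₗᵢ[ℝ] EuclideanSpace ℝ (Fin 3),
        (∀ x, ‖nearestDist y k • A k x - nearestDist y j • A j (R₁ x)‖ ≤
          5 / 2 * (2 * (1 / 10 ^ 4) * nearestDist y j + 1 / 10 ^ 4 * nearestDist y k) * ‖x‖) ∧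
        ExactDict y j (P j) (P k) (f j) (f k) v R₁ := by
  have hsj : 0 < nearestDist y j := nearestDist_pos_of_frame hy (hP j hj) (fun v hv => (hf j hj v hv).1) (hinj j hj)
  have hreg := (hf j hj v hv).2
  rw [hk] at hreg
  have hAv : ‖A j v‖ ≤ 1 + 1 / 1000 := by have h := norm_frame_le (hA j hj) hv; rw [hv1] at h; exact h
  have hAv' : 1 - 1 / 1000 ≤ ‖A j v‖ := one_sub_le_norm_frame (hP j hj) (hA j hj) hv
  have hn : ‖nearestDist y j • A j v‖ = nearestDist y j * ‖A j v‖ := by rw [norm_smul, Real.norm_of_nonneg hsj.le]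
  have hkj : k ≠ j := by
    intro e
    rw [e, dist_eq_norm, sub_add_cancel_left, norm_neg, hn] at hreg
    nlinarith
  have hdkj : dist (y k) (y j) ≤ (1 + 1 / 1000 + 1 / 10 ^ 4) * nearestDist y j := by
    have t := dist_triangle (y k) (y j + nearestDist y j • A j v) (y j)
    rw [dist_eq_norm (y j + _) (y j), add_sub_cancel_left, hn] at t
    nlinarith
  have hFj : AffFramed (1 / 10 ^ 4) (1 / 1000) (1 / 450) y j := ⟨Qf j, A j, P j, f j, hP j hj, hA j hj, hf j hj, hinj j hj, hex j hj⟩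
  have hFk : AffFramed (1 / 10 ^ 4) (1 / 1000) (1 / 450) y k := ⟨Qf k, A k, P k, f k, hP k hkr, hA k hkr, hf k hkr, hinj k hkr, hex k hkr⟩
  have hsc := affFramed_scale_transfer_record hy hFj hFk hkj hdkj
  have hsc' : nearestDist y k ≤ 10011 / 10000 * nearestDist y j := by
    have h := nearestDist_le_of_dist_le hkj hdkj
    norm_num at h ⊢
    exact h
  obtain ⟨R₁, hop, hD⟩ := exact_step_record hsj hsc hsc' (hP j hj) (hP k hkr) (hA j hj) (hA k hkr) (hf j hj) (hf k hkr) (hinj j hj)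
    (hex k hkr) hv hv1 hk (Ne.symm hkj)
  exact ⟨hkj, hsc, hsc', R₁, hop, hD⟩

/-- **LINK TRANSPORT.**  A frame link `‖s_j·A_j x − B (M x)‖ ≤ τ‖x‖` and an operator transport `‖s_k·A_k x − s_j·A_j (R₁ x)‖ ≤ η‖x‖` through an
exact isometry `R₁` compose ADDITIVELY to the link `‖s_k·A_k x − B (M (R₁ x))‖ ≤ (τ + η)‖x‖`. [this file] -/
theorem link_comp {sj sk τ η : ℝ} {Aj Ak B : EuclideanSpace ℝ (Fin 3) →ₗ[ℝ] EuclideanSpace ℝ (Fin 3)}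
    {M R₁ : EuclideanSpace ℝ (Fin 3) →ₗᵢ[ℝ] EuclideanSpace ℝ (Fin 3)}
    (hl : ∀ x, ‖sj • Aj x - B (M x)‖ ≤ τ * ‖x‖) (hop : ∀ x, ‖sk • Ak x - sj • Aj (R₁ x)‖ ≤ η * ‖x‖) :
    ∀ x, ‖sk • Ak x - B ((M.comp R₁) x)‖ ≤ (τ + η) * ‖x‖ := by
  intro z
  have h1 := hop z
  have h2 := hl (R₁ z)
  rw [R₁.norm_map] at h2
  rw [LinearIsometry.coe_comp, Function.comp_apply]
  have e : sk • Ak z - B (M (R₁ z)) = (sk • Ak z - sj • Aj (R₁ z)) + (sj • Aj (R₁ z) - B (M (R₁ z))) := by abel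
  rw [e, add_mul]
  exact (norm_add_le _ _).trans (by linarith)

/-- ★★ **ONE-PARENT ESTABLISHMENT.**  Ball data as in `bond_exact`; `j` established (chart `M` onto `C`, label `λ`, link `τ`, position `D`); `x ∈ C` a
first-shell copy vector listed in the offset list `xs` of two one-parent kernel tables (fcc child ↦ `Qsf`, hcp child ↦ `Qsh`); the predicted position in
the ball.  Then the site `k` registered at `M⁻¹(mv x)` is established: chart `M ∘ R₁` (`R₁` the exact dictionary of the bond, returned too) onto a copy
of the table matching `k`'s pattern type, link `τ + (5/2)(2·10⁻⁴·nn_j + 10⁻⁴·nn_k)`, label `λ + x`, position `D + 10⁻⁴·nn_j + τ`. [this file] -/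
theorem estab_child_one {y : Fin N → EuclideanSpace ℝ (Fin 3)} (hy : Function.Injective y) {r : ℝ} {i j : Fin N}
    {A : Fin N → (EuclideanSpace ℝ (Fin 3) →ₗ[ℝ] EuclideanSpace ℝ (Fin 3))} {Qf : Fin N → (EuclideanSpace ℝ (Fin 3) →ₗᵢ[ℝ] EuclideanSpace ℝ (Fin 3))}
    {P : Fin N → Finset (EuclideanSpace ℝ (Fin 3))} {f : Fin N → EuclideanSpace ℝ (Fin 3) → EuclideanSpace ℝ (Fin 3)}
    {B : EuclideanSpace ℝ (Fin 3) →ₗ[ℝ] EuclideanSpace ℝ (Fin 3)}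
    (hP : ∀ j, dist (y j) (y i) ≤ r → (P j = fccTwoShellPattern ∨ P j = hcpTwoShellPattern))
    (hA : ∀ j, dist (y j) (y i) ≤ r → ∀ v ∈ P j, ‖A j v - Qf j v‖ ≤ 1 / 1000)
    (hf : ∀ j, dist (y j) (y i) ≤ r → ∀ v ∈ P j, f j v ∈ Set.range y ∧ dist (f j v) (y j + nearestDist y j • A j v) ≤ 1 / 10 ^ 4 * nearestDist y j)
    (hinj : ∀ j, dist (y j) (y i) ≤ r → Set.InjOn (f j) ↑(P j))
    (hex : ∀ j, dist (y j) (y i) ≤ r → ∀ m, m ≠ j → dist (y m) (y j) ≤ (3 / 2 + 1 / 450) * nearestDist y j → ∃ v ∈ P j, f j v = y m)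
    (hj : dist (y j) (y i) ≤ r)
    {M : EuclideanSpace ℝ (Fin 3) →ₗᵢ[ℝ] EuclideanSpace ℝ (Fin 3)} {C : List T3} {lam : T3} {τ D : ℝ} (hE : Estab y A P B i j M C lam τ D)
    {x : T3} (hxC : x ∈ C) (hx18 : tsq x = 18) {xs : List T3} (hx : x ∈ xs) {Qsf Qsh : List (List T3)}
    (hKf : kernelOneB C xs fccL Qsf = true) (hKh : kernelOneB C xs hcpL Qsh = true)
    (hlf : ∀ Q ∈ Qsf, Q.length ≤ 18) (hlh : ∀ Q ∈ Qsh, Q.length ≤ 18)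
    (hball : ‖B (mv (tadd lam x))‖ + (D + 1 / 10 ^ 4 * nearestDist y j + τ) ≤ r) :
    ∃ k : Fin N, ∃ v ∈ P j, M v = mv x ∧ f j v = y k ∧ k ≠ j ∧ dist (y k) (y i) ≤ r ∧
      9967 / 10000 * nearestDist y j ≤ nearestDist y k ∧ nearestDist y k ≤ 10011 / 10000 * nearestDist y j ∧
      ∃ R₁ : EuclideanSpace ℝ (Fin 3) →ₗᵢ[ℝ] EuclideanSpace ℝ (Fin 3), ExactDict y j (P j) (P k) (f j) (f k) v R₁ ∧
        ∃ Q : List T3, ((P k = fccTwoShellPattern ∧ Q ∈ Qsf) ∨ (P k = hcpTwoShellPattern ∧ Q ∈ Qsh)) ∧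
          Estab y A P B i k (M.comp R₁) Q (tadd lam x)
            (τ + 5 / 2 * (2 * (1 / 10 ^ 4) * nearestDist y j + 1 / 10 ^ 4 * nearestDist y k)) (D + 1 / 10 ^ 4 * nearestDist y j + τ) := by
  have hC := hE.1
  have hlink := hE.2.1
  obtain ⟨v, hv, hMv⟩ := hC.2 x hxC
  have hv1 : ‖v‖ = 1 := by
    have h := (norm_mv_eq_one_iff x).2 hx18
    rwa [← hMv, M.norm_map] at h
  obtain ⟨k, hk⟩ := (hf j hj v hv).1
  have hposk : ‖y k - y i - B (mv (tadd lam x))‖ ≤ D + 1 / 10 ^ 4 * nearestDist y j + τ := child_position hE (hf j hj) hv hv1 hMv hk.symm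
  have hkr : dist (y k) (y i) ≤ r := by
    rw [dist_eq_norm]
    have e : y k - y i = (y k - y i - B (mv (tadd lam x))) + B (mv (tadd lam x)) := by abel
    rw [e]
    exact (norm_add_le _ _).trans (by linarith)
  obtain ⟨hkj, hsc, hsc', R₁, hop, hD⟩ := bond_exact hy hP hA hf hinj hex hj hkr hv hv1 hk.symm
  have hDc : ChartDict (M.comp R₁) M (P j) v (P k) := chartDict_of_exactDict M hD
  have hcard : (P k).card = 18 := card_eq_eighteen_of_twoShellPattern (hP k hkr)
  have hlink' := link_comp hlink hop
  refine ⟨k, v, hv, hMv, hk.symm, hkj, hkr, hsc, hsc', R₁, hD, ?_⟩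
  rcases hP k hkr with hPk | hPk
  · have hL : ListedBy (P k) fccL := by rw [hPk]; exact listedBy_fcc
    obtain ⟨Q, hQ, hCQ⟩ := kernel_step_one hKf hx hDc hC hMv hv1 (Or.inl rfl) hL hcard hlf
    exact ⟨Q, Or.inl ⟨hPk, hQ⟩, hCQ, hlink', hposk⟩
  · have hL : ListedBy (P k) hcpL := by rw [hPk]; exact listedBy_hcp
    obtain ⟨Q, hQ, hCQ⟩ := kernel_step_one hKh hx hDc hC hMv hv1 (Or.inr rfl) hL hcard hlh
    exact ⟨Q, Or.inr ⟨hPk, hQ⟩, hCQ, hlink', hposk⟩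

/-- **Record instance (parent `F⁺`, tables KF).**  From an established site charted onto `F⁺` every one of its twelve bonds establishes the child: onto `F⁺`
again if the child is fcc (`kf_fcc`), onto one of the eight adjacent hcp copies `hcpFamilyL` if it is hcp (`kf_hcp`). [this file] -/
theorem estab_child_fcc {y : Fin N → EuclideanSpace ℝ (Fin 3)} (hy : Function.Injective y) {r : ℝ} {i j : Fin N}
    {A : Fin N → (EuclideanSpace ℝ (Fin 3) →ₗ[ℝ] EuclideanSpace ℝ (Fin 3))} {Qf : Fin N → (EuclideanSpace ℝ (Fin 3) →ₗᵢ[ℝ] EuclideanSpace ℝ (Fin 3))}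
    {P : Fin N → Finset (EuclideanSpace ℝ (Fin 3))} {f : Fin N → EuclideanSpace ℝ (Fin 3) → EuclideanSpace ℝ (Fin 3)}
    {B : EuclideanSpace ℝ (Fin 3) →ₗ[ℝ] EuclideanSpace ℝ (Fin 3)}
    (hP : ∀ j, dist (y j) (y i) ≤ r → (P j = fccTwoShellPattern ∨ P j = hcpTwoShellPattern))
    (hA : ∀ j, dist (y j) (y i) ≤ r → ∀ v ∈ P j, ‖A j v - Qf j v‖ ≤ 1 / 1000)
    (hf : ∀ j, dist (y j) (y i) ≤ r → ∀ v ∈ P j, f j v ∈ Set.range y ∧ dist (f j v) (y j + nearestDist y j • A j v) ≤ 1 / 10 ^ 4 * nearestDist y j)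
    (hinj : ∀ j, dist (y j) (y i) ≤ r → Set.InjOn (f j) ↑(P j))
    (hex : ∀ j, dist (y j) (y i) ≤ r → ∀ m, m ≠ j → dist (y m) (y j) ≤ (3 / 2 + 1 / 450) * nearestDist y j → ∃ v ∈ P j, f j v = y m)
    (hj : dist (y j) (y i) ≤ r)
    {M : EuclideanSpace ℝ (Fin 3) →ₗᵢ[ℝ] EuclideanSpace ℝ (Fin 3)} {lam : T3} {τ D : ℝ} (hE : Estab y A P B i j M fccL lam τ D)
    {x : T3} (hxC : x ∈ fccL) (hx18 : tsq x = 18) (hball : ‖B (mv (tadd lam x))‖ + (D + 1 / 10 ^ 4 * nearestDist y j + τ) ≤ r) :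
    ∃ k : Fin N, ∃ v ∈ P j, M v = mv x ∧ f j v = y k ∧ k ≠ j ∧ dist (y k) (y i) ≤ r ∧
      9967 / 10000 * nearestDist y j ≤ nearestDist y k ∧ nearestDist y k ≤ 10011 / 10000 * nearestDist y j ∧
      ∃ R₁ : EuclideanSpace ℝ (Fin 3) →ₗᵢ[ℝ] EuclideanSpace ℝ (Fin 3), ExactDict y j (P j) (P k) (f j) (f k) v R₁ ∧
        ∃ Q : List T3, ((P k = fccTwoShellPattern ∧ Q ∈ [fccL]) ∨ (P k = hcpTwoShellPattern ∧ Q ∈ hcpFamilyL)) ∧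
          Estab y A P B i k (M.comp R₁) Q (tadd lam x)
            (τ + 5 / 2 * (2 * (1 / 10 ^ 4) * nearestDist y j + 1 / 10 ^ 4 * nearestDist y k)) (D + 1 / 10 ^ 4 * nearestDist y j + τ) :=
  estab_child_one hy hP hA hf hinj hex hj hE hxC hx18 (List.mem_filter.2 ⟨hxC, by simp [hx18]⟩) kf_fcc kf_hcp (by decide) (by decide) hball

/-! ## §2  Chart uniqueness by frame link -/

/-- **Affine frames are bounded below.**  A linear `A` that is `θ`-close to a linear isometry on a two-shell pattern satisfies `‖A z‖ ≥ (1 − 5θ/2)‖z‖`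
for every `z` (operator bound of `A − Q` from a tetrahedral unit triple of pattern points, `…Op.op_of_tetra_bound_all`). [this file] -/
theorem frame_lower {θ : ℝ} {A : EuclideanSpace ℝ (Fin 3) →ₗ[ℝ] EuclideanSpace ℝ (Fin 3)} {Q : EuclideanSpace ℝ (Fin 3) →ₗᵢ[ℝ] EuclideanSpace ℝ (Fin 3)}
    {P : Finset (EuclideanSpace ℝ (Fin 3))} (hP : P = fccTwoShellPattern ∨ P = hcpTwoShellPattern) (hA : ∀ v ∈ P, ‖A v - Q v‖ ≤ θ) :
    ∀ z, (1 - 5 / 2 * θ) * ‖z‖ ≤ ‖A z‖ := by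
  have hvk : mv (3, 3, 0) ∈ P := by
    rcases hP with rfl | rfl
    · exact listedBy_fcc.2 _ (by decide)
    · exact listedBy_hcp.2 _ (by decide)
  have hvk1 : ‖mv (3, 3, 0)‖ = 1 := (norm_mv_eq_one_iff _).2 (by decide)
  obtain ⟨b, hb, c, hc, hb1, hc1, -, -, -, ivb, ivc, ibc⟩ := tetra_exists_pattern hP hvk hvk1
  have hM : ∀ w ∈ P, ‖(A - Q.toLinearMap) w‖ ≤ θ := fun w hw => by
    rw [LinearMap.sub_apply, LinearIsometry.coe_toLinearMap]; exact hA w hw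
  have hop := op_of_tetra_bound_all (M := A - Q.toLinearMap) hvk1 hb1 hc1 ivb ivc ibc (hM _ hvk) (hM b hb) (hM c hc)
  intro z
  have h1 := hop z
  rw [LinearMap.sub_apply, LinearIsometry.coe_toLinearMap] at h1
  have h2 : ‖Q z‖ - ‖A z‖ ≤ ‖Q z - A z‖ := norm_sub_norm_le _ _
  rw [Q.norm_map, norm_sub_rev] at h2
  linarith

/-- **The seed base frame is bounded below**: `‖(nn_i·A_i) z‖ ≥ (399/400)·nn_i·‖z‖` at the record frame tolerance `10⁻³`. [this file] -/
theorem base_lower {y : Fin N → EuclideanSpace ℝ (Fin 3)} {i : Fin N} {Ai : EuclideanSpace ℝ (Fin 3) →ₗ[ℝ] EuclideanSpace ℝ (Fin 3)}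
    {Qi : EuclideanSpace ℝ (Fin 3) →ₗᵢ[ℝ] EuclideanSpace ℝ (Fin 3)} {Pi : Finset (EuclideanSpace ℝ (Fin 3))}
    (hP : Pi = fccTwoShellPattern ∨ Pi = hcpTwoShellPattern) (hA : ∀ v ∈ Pi, ‖Ai v - Qi v‖ ≤ 1 / 1000) :
    ∀ z, 399 / 400 * nearestDist y i * ‖z‖ ≤ ‖(nearestDist y i • Ai) z‖ := by
  intro z
  have h := frame_lower hP hA z
  rw [LinearMap.smul_apply, norm_smul, Real.norm_of_nonneg (nearestDist_nonneg y i)]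
  have h0 := nearestDist_nonneg y i
  nlinarith [norm_nonneg z]

/-- A frame link forces `0 ≤ τ`. [this file] -/
theorem link_nonneg {T : EuclideanSpace ℝ (Fin 3) → EuclideanSpace ℝ (Fin 3)} {B : EuclideanSpace ℝ (Fin 3) →ₗ[ℝ] EuclideanSpace ℝ (Fin 3)}
    {M : EuclideanSpace ℝ (Fin 3) →ₗᵢ[ℝ] EuclideanSpace ℝ (Fin 3)} {τ : ℝ} (hl : ∀ x, ‖T x - B (M x)‖ ≤ τ * ‖x‖) : 0 ≤ τ := by
  have h := hl (mv (3, 3, 0))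
  rw [(norm_mv_eq_one_iff _).2 (by decide), mul_one] at h
  exact (norm_nonneg _).trans h

/-- **Two charts of one site linked to the same base frame are close**: `β‖M x − M′ x‖ ≤ (τ + τ′)‖x‖` when `‖B z‖ ≥ β‖z‖`. [this file] -/
theorem charts_close {B : EuclideanSpace ℝ (Fin 3) →ₗ[ℝ] EuclideanSpace ℝ (Fin 3)} {β : ℝ} (hB : ∀ z, β * ‖z‖ ≤ ‖B z‖)
    {T : EuclideanSpace ℝ (Fin 3) → EuclideanSpace ℝ (Fin 3)} {M M' : EuclideanSpace ℝ (Fin 3) →ₗᵢ[ℝ] EuclideanSpace ℝ (Fin 3)} {τ τ' : ℝ}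
    (hl : ∀ x, ‖T x - B (M x)‖ ≤ τ * ‖x‖) (hl' : ∀ x, ‖T x - B (M' x)‖ ≤ τ' * ‖x‖) :
    ∀ x, β * ‖M x - M' x‖ ≤ (τ + τ') * ‖x‖ := by
  intro x
  have h1 := hB (M x - M' x)
  have e : B (M x - M' x) = (T x - B (M' x)) - (T x - B (M x)) := by rw [map_sub]; abel
  rw [e] at h1
  have h2 := norm_sub_le (T x - B (M' x)) (T x - B (M x))
  have h3 := hl x
  have h4 := hl' x
  linarith

/-- The four aligned copies are `1`-separated in model units (`tsq ≥ 18` between distinct members; by `decide`). [this file] -/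
theorem copies_separated : ∀ C ∈ [fccL, fccNegL, hcpL, hcpAltL], ∀ V ∈ C, ∀ W ∈ C, V ≠ W → 18 ≤ tsq (tsub V W) := by decide

/-- ★ **CHART UNIQUENESS.**  Two charts carrying one pattern onto the SAME `1`-separated copy and `< 1` apart on the pattern are EQUAL (they agree on every
pattern point, and the pattern spans `ℝ³`). [this file] -/
theorem chart_eq_of_carries {M M' : EuclideanSpace ℝ (Fin 3) →ₗᵢ[ℝ] EuclideanSpace ℝ (Fin 3)} {P : Finset (EuclideanSpace ℝ (Fin 3))} {S C : List T3}
    (hS : S = fccL ∨ S = hcpL) (hL : ListedBy P S) (hsep : ∀ V ∈ C, ∀ W ∈ C, V ≠ W → 18 ≤ tsq (tsub V W))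
    (hM : Carries M P C) (hM' : Carries M' P C) (hclose : ∀ v ∈ P, ‖M v - M' v‖ < 1) : ∀ x, M x = M' x := by
  have hPt : ∀ v ∈ P, M v = M' v := by
    intro v hv
    obtain ⟨V, hV, hMV⟩ := hM.1 v hv
    obtain ⟨V', hV', hMV'⟩ := hM'.1 v hv
    by_contra hne
    have hVV : V ≠ V' := fun h => hne (by rw [hMV, hMV', h])
    have h18 : (18 : ℝ) ≤ tsq (tsub V V') := by exact_mod_cast hsep V hV V' hV' hVV
    have hsq := norm_mv_sq (tsub V V')
    rw [mv_tsub, ← hMV, ← hMV'] at hsq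
    have hc := hclose v hv
    nlinarith [norm_nonneg (M v - M' v)]
  have m6 : ((6 : ℤ), (0 : ℤ), (0 : ℤ)) ∈ S ∧ ((0 : ℤ), (6 : ℤ), (0 : ℤ)) ∈ S ∧ ((0 : ℤ), (0 : ℤ), (6 : ℤ)) ∈ S := by
    rcases hS with rfl | rfl <;> decide
  have hli : LinearIndependent ℝ ![mv (6, 0, 0), mv (0, 6, 0), mv (0, 0, 6)] := linearIndependent_mv (by decide)
  have key := linearMap_eq_of_eq_on_triple (T := M.toLinearMap) (T' := M'.toLinearMap) hli (fun t => by
    fin_cases t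
    · simpa using hPt _ (hL.2 _ m6.1)
    · simpa using hPt _ (hL.2 _ m6.2.1)
    · simpa using hPt _ (hL.2 _ m6.2.2))
  intro x
  simpa using LinearMap.congr_fun key x

/-- Two pattern points charted to model points at model distance `1` are at distance `1`. [this file] -/
theorem norm_sub_eq_one_of_chart (M : EuclideanSpace ℝ (Fin 3) →ₗᵢ[ℝ] EuclideanSpace ℝ (Fin 3)) {p q : EuclideanSpace ℝ (Fin 3)} {X Y : T3}
    (hp : M p = mv X) (hq : M q = mv Y) (h : tsq (tsub X Y) = 18) : ‖p - q‖ = 1 := by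
  have h1 : ‖M (p - q)‖ = ‖p - q‖ := M.norm_map _
  rw [map_sub, hp, hq, ← mv_tsub, (norm_mv_eq_one_iff _).2 h] at h1
  exact h1.symm

/-- `λ₁ + (λ₂ − λ₁) = λ₂`. [this file] -/
theorem tadd_tsub_cancel (a b : T3) : tadd a (tsub b a) = b := by
  obtain ⟨a₁, a₂, a₃⟩ := a
  obtain ⟨b₁, b₂, b₃⟩ := b
  simp only [tadd, tsub]
  refine Prod.ext ?_ (Prod.ext ?_ ?_) <;> simp

/-- `(λ₂ − λ₁) − (q − λ₁) = −(q − λ₂)` at the level of `tsq`. [this file] -/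
theorem tsq_tsub_tsub (q l₁ l₂ : T3) : tsq (tsub (tsub l₂ l₁) (tsub q l₁)) = tsq (tsub q l₂) := by
  obtain ⟨a₁, a₂, a₃⟩ := q
  obtain ⟨b₁, b₂, b₃⟩ := l₁
  obtain ⟨c₁, c₂, c₃⟩ := l₂
  simp only [tsq, tsub]
  ring

end Summit.AtomisticToContinuum.Crystallization.Theorems.OverbindingBudgetAffineCompressedCutEstablish
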